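import Literature.NumberTheory.Sieve.RosserSieveTwisted
import Literature.NumberTheory.Sieve.ChenTwinSieveUpperSum
import Literature.NumberTheory.Sieve.ChenTwinProofs
import Literature.NumberTheory.Sieve.ChenTheoremIUpperSieveTools
import Literature.NumberTheory.Sieve.LiouvilleSiftedClasses
import Literature.NumberTheory.Sieve.ParityBarrier
import HarnessLib

/-!
# Route `ChenParityOracleBLAP` — crux `ParityOracleChen` (stmt-Parity-20046): parity bookkeeping

Support file 1/5 for S2 = `ParityOracleChen` (`HP1 → HP2 → TwinLowerDensity`): the elementary
parity-oracle bookkeeping shared by the three twisted Chen estimates (A′), (B′), (C′) —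
`½(1 − λ(n))` is the indicator of `λ(n) = −1` for `n ≠ 0`; the twisted sifted sum of an indicator
sequence `1_S` against `e = 1_S λ` is the rough count of the parity subset `{n ∈ S : λ(n) = −1}`;
the oracle congruence sums are `∑_{n ∈ S, d ∣ n} λ(n)`; rearrangements of the oracle remainders
(`(q, d) ↦ qd` injective on `q ≥ ⌈w⌉` prime, `d ∣ P(w)`); and the identification lemmas for the
tree's sequences `𝒜_q = twinSeqMult x q` (Nathanson §10.5). The sieve input is the twisted Rosser
sieve `Literature.NumberTheory.Sieve.Iwaniec1980_twisted_{upper,lower}_of_half_lt`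
(`RosserSieveTwisted.lean`).

References: Chen Jing-run, Sci. Sinica 16 (1973) [ChenSciSinica1973]; M. B. Nathanson, *Additive
Number Theory: The Classical Bases* (1996), Ch. 10 [Nathanson1996]; H. Iwaniec, Acta Arith. 36 (1980)
[IwaniecActaArith1980].
-/

namespace Summit.Parity.GeneralizedHardyLittlewood.Theorems

open Finset Filter Topology
open scoped ArithmeticFunction.Moebius ArithmeticFunction.Omega
open Literature.NumberTheory.Sieve Literature.NumberTheory.Sieve.Chen
  Literature.NumberTheory.Sieve.ChenSieve Literature.NumberTheory.Sieve.SieveSequence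

/-- The parity oracle: for `n ≠ 0`, `½(1 − λ(n)) = 1` if `λ(n) = −1` and `= 0` otherwise. -/
theorem half_one_sub_liouville {n : ℕ} (hn : n ≠ 0) :
    ((1 : ℝ) - (ArithmeticFunction.liouville n : ℝ)) / 2 =
      if ArithmeticFunction.liouville n = -1 then 1 else 0 := by
  rcases LiouvilleSifted.liouville_eq_one_or n hn with h | h
  · rw [h]; norm_num
  · rw [h]; norm_num

/-- If `λ(n) = −1` and `Ω(n) ≤ 2`, `n ≠ 0`, then `n` is prime (`Ω(n)` is odd and `≤ 2`, so `= 1`). -/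
theorem prime_of_liouville_eq_neg_one_of_isAtMostAlmostPrime_two {n : ℕ}
    (hl : ArithmeticFunction.liouville n = -1) (h2 : Nat.IsAtMostAlmostPrime 2 n) : n.Prime := by
  obtain ⟨hn, hΩ⟩ := h2
  rw [ArithmeticFunction.liouville_apply hn] at hl
  have hodd : Odd (Ω n) := by
    by_contra h
    rw [Nat.not_odd_iff_even] at h
    rw [h.neg_one_pow] at hl
    norm_num at hl
  have h1 : Ω n = 1 := by rcases hodd with ⟨k, hk⟩; omega
  exact ArithmeticFunction.cardFactors_eq_one_iff_prime.mp h1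

/-- **The twisted sifted sum of an indicator sequence is the rough count of its parity subset.**
For a finite set `S` of positive integers `≤ M` and the weights `a = 1_S`, `e = 1_S · λ`:
`∑_{n ≤ M, (n, P(w)) = 1} ½(a(n) − e(n)) = #{n ∈ S : λ(n) = −1, n has no prime factor < w}`
(`roughCount` of the parity subset at `⌈w⌉`). -/
theorem twistedSifted_indicator_eq (S : Finset ℕ) {M : ℕ} (hS : S ⊆ Finset.Ioc 0 M) (w : ℝ) :
    ∑ n ∈ (Finset.Ioc 0 ⌊((M : ℕ) : ℝ)⌋₊).filter (fun n : ℕ => n.Coprime (primesProdBelow w)),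
        ((if n ∈ S then (1 : ℝ) else 0) -
          (if n ∈ S then (1 : ℝ) else 0) * (ArithmeticFunction.liouville n : ℝ)) / 2 =
      (roughCount (S.filter fun n => ArithmeticFunction.liouville n = -1) ⌈w⌉₊ : ℝ) := by
  classical
  rw [Nat.floor_natCast, roughCount, Finset.filter_filter]
  have hS0 : ∀ n ∈ S, n ≠ 0 := fun n hn => by
    have := (Finset.mem_Ioc.mp (hS hn)).1; omega
  -- rewrite the summand as an indicator
  have hsummand : ∀ n ∈ (Finset.Ioc 0 M).filter (fun n : ℕ => n.Coprime (primesProdBelow w)),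
      ((if n ∈ S then (1 : ℝ) else 0) -
          (if n ∈ S then (1 : ℝ) else 0) * (ArithmeticFunction.liouville n : ℝ)) / 2 =
        if n ∈ S ∧ ArithmeticFunction.liouville n = -1 then 1 else 0 := by
    intro n _
    by_cases hn : n ∈ S
    · rw [if_pos hn, one_mul, half_one_sub_liouville (hS0 n hn)]
      by_cases hl : ArithmeticFunction.liouville n = -1
      · rw [if_pos hl, if_pos ⟨hn, hl⟩]
      · rw [if_neg hl, if_neg (fun h => hl h.2)]
    · rw [if_neg hn, if_neg (fun h => hn h.1)]; ring
  rw [Finset.sum_congr rfl hsummand, ← Finset.sum_filter, Finset.sum_const, nsmul_eq_mul, mul_one,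
    Finset.filter_filter]
  congr 2
  ext n
  simp only [Finset.mem_filter, Finset.mem_Ioc]
  constructor
  · rintro ⟨-, hcop, hn, hl⟩
    exact ⟨hn, hl, (Chen.coprime_primesProdBelow_iff_isRough (hS0 n hn)).mp hcop⟩
  · rintro ⟨hn, hl, hr⟩
    have h := Finset.mem_Ioc.mp (hS hn)
    exact ⟨⟨h.1, h.2⟩, (Chen.coprime_primesProdBelow_iff_isRough (hS0 n hn)).mpr hr, hn, hl⟩

/-- **The oracle remainder of an indicator sequence.** For `S ⊆ (0, M]` and `e = 1_S · λ`:
`∑_{n ≤ M, d ∣ n} e(n) = ∑_{n ∈ S, d ∣ n} λ(n)`. -/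
theorem twistedCongrSum_indicator_eq (S : Finset ℕ) {M : ℕ} (hS : S ⊆ Finset.Ioc 0 M) (d : ℕ) :
    ∑ n ∈ (Finset.Ioc 0 ⌊((M : ℕ) : ℝ)⌋₊).filter (d ∣ ·),
        (if n ∈ S then (1 : ℝ) else 0) * (ArithmeticFunction.liouville n : ℝ) =
      ∑ n ∈ S.filter (fun n => d ∣ n), (ArithmeticFunction.liouville n : ℝ) := by
  classical
  rw [Nat.floor_natCast]
  have h1 : ∑ n ∈ (Finset.Ioc 0 M).filter (d ∣ ·),
      (if n ∈ S then (1 : ℝ) else 0) * (ArithmeticFunction.liouville n : ℝ) =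
      ∑ n ∈ (Finset.Ioc 0 M).filter (d ∣ ·),
        (if n ∈ S then (ArithmeticFunction.liouville n : ℝ) else 0) :=
    Finset.sum_congr rfl fun n _ => by split_ifs <;> simp
  rw [h1, ← Finset.sum_filter, Finset.filter_filter]
  congr 1
  ext n
  simp only [Finset.mem_filter]
  constructor
  · rintro ⟨-, hd, hn⟩; exact ⟨hn, hd⟩
  · rintro ⟨hn, hd⟩; exact ⟨hS hn, hd, hn⟩

/-- **From the Rosser-weight range to an initial segment.** For `F ≥ 0` and `0 ≤ Y`:
`∑_{d < Y, d ∣ P(w)} F(d) ≤ ∑_{1 ≤ d ≤ ⌊Y⌋} F(d)`. -/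
theorem sum_range_filter_dvd_le_sum_Icc {F : ℕ → ℝ} (hF : ∀ d, 0 ≤ F d) (w : ℝ) {Y : ℝ} :
    ∑ d ∈ (Finset.range ⌈Y⌉₊).filter (· ∣ primesProdBelow w), F d ≤
      ∑ d ∈ Finset.Icc 1 ⌊Y⌋₊, F d := by
  refine Finset.sum_le_sum_of_subset_of_nonneg (fun d hd => ?_) fun d _ _ => hF d
  rw [Finset.mem_filter, Finset.mem_range] at hd
  rw [Finset.mem_Icc]
  refine ⟨Nat.pos_of_dvd_of_pos hd.2 (Nat.pos_of_ne_zero (primesProdBelow_ne_zero w)),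
    Nat.le_floor ?_⟩
  exact (Nat.lt_ceil.mp hd.1).le

/-- **Rearranging a double oracle sum** (the signed analogue of
`Chen.sum_sum_abs_primeCountingDisc_le`): for `F ≥ 0`,
`∑_{⌈w⌉ ≤ q < v prime} ∑_{d < D/q, d ∣ P(w)} F(qd) ≤ ∑_{1 ≤ m ≤ ⌊D⌋} F(m)` — the map `(q, d) ↦ qd`
is injective on these pairs (a prime `q ≥ ⌈w⌉` does not divide a divisor of `P(w)`) and `qd < D`. -/
theorem sum_primesIco_sum_le_sum_Icc {F : ℕ → ℝ} (hF : ∀ m, 0 ≤ F m) (v : ℕ) (w D : ℝ) :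
    ∑ q ∈ primesIco ⌈w⌉₊ v, ∑ d ∈ (Finset.range ⌈D / q⌉₊).filter (· ∣ primesProdBelow w),
        F (q * d) ≤ ∑ m ∈ Finset.Icc 1 ⌊D⌋₊, F m := by
  classical
  set Q := primesIco ⌈w⌉₊ v with hQ
  set T : ℕ → Finset ℕ := fun q => (Finset.range ⌈D / q⌉₊).filter (· ∣ primesProdBelow w) with hT
  have hQmem : ∀ q ∈ Q, q.Prime ∧ ⌈w⌉₊ ≤ q := fun q hq => by
    rw [hQ, primesIco, Finset.mem_filter, Finset.mem_Ico] at hq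
    exact ⟨hq.2, hq.1.1⟩
  have hTmem : ∀ q d, d ∈ T q → d ∣ primesProdBelow w ∧ (d : ℝ) < D / q := fun q d hd => by
    simp only [hT, Finset.mem_filter, Finset.mem_range, Nat.lt_ceil] at hd
    exact ⟨hd.2, hd.1⟩
  have hndvd : ∀ q d, q.Prime → ⌈w⌉₊ ≤ q → d ∣ primesProdBelow w → ¬ q ∣ d := by
    intro q d hq hqz hd hqd
    have hqlt : (q : ℝ) < w := (dvd_primesProdBelow_iff hq w).mp (hqd.trans hd)
    have : q < ⌈w⌉₊ := Nat.lt_ceil.mpr hqlt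
    omega
  have h1 : ∑ q ∈ Q, ∑ d ∈ T q, F (q * d) = ∑ σ ∈ Q.sigma T, F (σ.1 * σ.2) :=
    (Finset.sum_sigma Q T (fun σ => F (σ.1 * σ.2))).symm
  have hinj : Set.InjOn (fun σ : (Σ _ : ℕ, ℕ) => σ.1 * σ.2) ↑(Q.sigma T) := by
    rintro ⟨q, d⟩ hσ ⟨q', d'⟩ hσ' heq
    rw [Finset.mem_coe, Finset.mem_sigma] at hσ hσ'
    simp only at heq
    obtain ⟨hq, hqz⟩ := hQmem q hσ.1
    obtain ⟨hq', hqz'⟩ := hQmem q' hσ'.1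
    have hd := (hTmem q d hσ.2).1
    have hd' := (hTmem q' d' hσ'.2).1
    have hqq' : q = q' := by
      have h2 : q ∣ q' * d' := heq ▸ dvd_mul_right q d
      rcases (Nat.Prime.dvd_mul hq).mp h2 with h3 | h3
      · exact (Nat.prime_dvd_prime_iff_eq hq hq').mp h3
      · exact absurd h3 (hndvd q d' hq hqz hd')
    subst hqq'
    have hdd' : d = d' := Nat.eq_of_mul_eq_mul_left hq.pos heq
    subst hdd'
    rfl
  change ∑ q ∈ Q, ∑ d ∈ T q, F (q * d) ≤ ∑ m ∈ Finset.Icc 1 ⌊D⌋₊, F m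
  rw [h1, ← Finset.sum_image hinj]
  refine Finset.sum_le_sum_of_subset_of_nonneg (fun m hm => ?_) fun m _ _ => hF m
  rw [Finset.mem_image] at hm
  obtain ⟨⟨q, d⟩, hσ, rfl⟩ := hm
  rw [Finset.mem_sigma] at hσ
  obtain ⟨hq, -⟩ := hQmem q hσ.1
  obtain ⟨hd, hdlt⟩ := hTmem q d hσ.2
  have hd0 : d ≠ 0 := fun h0 => by
    rw [h0, zero_dvd_iff] at hd; exact primesProdBelow_ne_zero w hd
  have hq0 : (0 : ℝ) < q := by exact_mod_cast hq.pos
  rw [Finset.mem_Icc]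
  refine ⟨Nat.one_le_iff_ne_zero.mpr (mul_ne_zero hq.ne_zero hd0), Nat.le_floor ?_⟩
  rw [lt_div_iff₀' hq0] at hdlt
  push_cast
  exact hdlt.le

/-! ### Identification lemmas for the sequences `𝒜_q` (used by (B′)) -/

/-- The weights of `𝒜_q` are the indicator of `{n ∈ 𝒜(x) : q ∣ n}`. -/
theorem twinWeightMult_eq_indicator (x q n : ℕ) :
    twinWeightMult x q n = if n ∈ (twinSieveSet x).filter (fun n => q ∣ n) then (1 : ℝ) else 0 := by
  unfold twinWeightMult
  simp only [Finset.mem_filter]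

/-- The twisted sifted sum of `𝒜_q` at height `x + 2` is `S(𝒜′(x)_q, ⌈w⌉)` (`roughMultCount` of the
parity subset). -/
theorem twistedSifted_twinSeqMult_eq (x q : ℕ) (w : ℝ) :
    ∑ n ∈ (Finset.Ioc 0 ⌊((x + 2 : ℕ) : ℝ)⌋₊).filter (fun n : ℕ => n.Coprime (primesProdBelow w)),
        (twinWeightMult x q n - twinWeightMult x q n * (ArithmeticFunction.liouville n : ℝ)) / 2 =
      (roughMultCount ((twinSieveSet x).filter fun n => ArithmeticFunction.liouville n = -1) ⌈w⌉₊ q : ℝ) := by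
  classical
  have hS : (twinSieveSet x).filter (fun n => q ∣ n) ⊆ Finset.Ioc 0 (x + 2) :=
    (Finset.filter_subset _ _).trans (twinSieveSet_subset_Ioc x)
  have h := twistedSifted_indicator_eq ((twinSieveSet x).filter (fun n => q ∣ n)) hS w
  simp only [← twinWeightMult_eq_indicator] at h
  rw [h, roughCount, roughMultCount, Finset.filter_filter, Finset.filter_filter]
  congr 2
  ext n
  simp only [Finset.mem_filter]
  tauto

/-- The oracle remainder of `𝒜_q`: for `(q, d) = 1`, `E_d(x + 2) = Λ_{qd}(x) = ∑_{n ∈ 𝒜(x), qd ∣ n} λ(n)`. -/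
theorem twistedCongrSum_twinSeqMult_eq {x q d : ℕ} (hqd : q.Coprime d) :
    ∑ n ∈ (Finset.Ioc 0 ⌊((x + 2 : ℕ) : ℝ)⌋₊).filter (d ∣ ·),
        twinWeightMult x q n * (ArithmeticFunction.liouville n : ℝ) =
      ∑ n ∈ (twinSieveSet x).filter (fun n => q * d ∣ n), (ArithmeticFunction.liouville n : ℝ) := by
  classical
  have hS : (twinSieveSet x).filter (fun n => q ∣ n) ⊆ Finset.Ioc 0 (x + 2) :=
    (Finset.filter_subset _ _).trans (twinSieveSet_subset_Ioc x)
  have h := twistedCongrSum_indicator_eq ((twinSieveSet x).filter (fun n => q ∣ n)) hS d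
  simp only [← twinWeightMult_eq_indicator] at h
  rw [h, Finset.filter_filter]
  congr 1
  ext n
  simp only [Finset.mem_filter]
  constructor
  · rintro ⟨hn, hq, hd⟩; exact ⟨hn, hqd.mul_dvd_of_dvd_of_dvd hq hd⟩
  · rintro ⟨hn, hqd'⟩; exact ⟨hn, (dvd_mul_right q d).trans hqd', (dvd_mul_left d q).trans hqd'⟩

end Summit.Parity.GeneralizedHardyLittlewood.Theorems
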